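import Literature.MathematicalPhysics.QuantumFieldTheory.Balaban1983to89.B9Thm311DeltaPrimeA

/-!
# `Balaban1983to89.B9Eq325ProjFormula` — T. Bałaban, *Propagators for lattice gauge theories in a background field*, Commun. Math. Phys.
# **99** (1985) 389–434 [Balaban1985BackgroundPropagators] (3.21)–(3.25) p. 394: **THE GAUGE-FIXING PROJECTION `R(U)` OF THE pub-balaban NE9
# CHAIN (`B9Eq326OperatorAssembly.RofU`, the orthogonal projection onto `Δ^η_U N(Q′(U))`) EQUALS PRINT'S FORMULA (3.25)
# `R = I − G′Q′*(Q′G′²Q′*)⁻¹Q′G′` AT EVERY UNITARY BACKGROUND, WITH `G′ = (Δ′_a(U))⁻¹` (`B9Eq3119DeltaPiCarrier.GpOfU`) AND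
# `(Q′G′²Q′*)⁻¹` CONSTRUCTED** — over `RCLike 𝕜` from ONE-SIDED Green data (no port of the real-scalar `B5Projector144` ∕ `B9Eq325Proj`)

statement-level skeleton of published theorems with citation tags; proofs where landed; nothing here is a claim about the Yang–Mills mass gap

CITATION HEADER (lean-in-tree rule).  Audit cell `pub-balaban`, sub-cell `t4`, BINDER row NE9; filed by NE9 formalisation-swarm leaf prover 06
(`b2b-balaban-t4-ne9-formalise-leaf-06`, gen 63) as sub-step S3a of route R2′ STEP B7′ (`t4/ROUTES-NE9.md` v13.19 l.407, crux ideation lens 1,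
hand-off by name).  Source READ in the held text: [Balaban1985BackgroundPropagators] pp. 393–394 (`paper:balaban1985-cmp99-background-propagators`,
journal page = PDF page + 388): (3.17)–(3.25).

THE PRINT (verbatim, p. 394).  *«(3.17) = exp(−(1∕2α)‖RD*A‖²), (3.20) where R = R(U) is an orthogonal projection in the Hilbert space L²(Ω₀, 𝔤)
onto the subspace R = Δ^η_U N(Q′), N(Q′) = {λ : Q′λ = 0}. (3.21) … Let us introduce the operator Δ′_a = Δ′_a(U) = (Δ^η_U + Q′*aQ′)↾_{Ω₀} … (3.24)
… Its inverse is denoted by G′, or G′(U). … Using the Lagrange multipliers method the minimum of (3.22) can be found by the same calculations as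
in [4], (2.15)–(2.17), and we obtain the formula Rf = (I − G′Q′*(Q′G′²Q′*)⁻¹Q′G′)f, (3.25) where G′ = G′(U) = (Δ′_a)⁻¹. We do not know yet if
the operators in the above formulas are well defined. … Assuming some regularity of the configuration U it can be easily shown that the operator
Δ′_a is positive.»*

WHY (route R2′ STEP B7′, sub-step S3a).  The chain CONSTRUCTS `R(U)` as Mathlib's orthogonal projection (`B11Eq103H1Complex.projR` ↦
`RLatticeK` ↦ `B9Eq326OperatorAssembly.RofU`); every perturbative statement about `R(U)` print makes on pp. 402–403 ((3.63)–(3.68): `R`, `P = I − R`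
«extend analytically … and satisfy the same bounds») goes through the RESOLVENT FORMULA (3.25).  The cell's kernel certificate of (3.25) = (3.21),
`B9Eq325Proj.R325_eq_starProjection` (sub-cell b09), is typed over REAL inner-product spaces with two-sided `Data`; the chain lives over `ℂ`.  This file
proves the identity over `RCLike 𝕜` from the four facts the proof actually uses — `Δ′` agrees with `Δ^η_U` on `N(Q′)`, `Δ′` is symmetric, `Δ′∘G′ = id`,
`(Q′G′²Q′*)∘c = id` (§1) — and DISCHARGES them for the chain (§2–§3): `Δ′ := B9Eq3119DeltaPiCarrier.laplacePrimeA` (symmetric for mutually adjoint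
transporters, §2), `G′ := GpOfU` (`B11Eq103H1Complex.apply_greenK`), `Q′* := Q′†` on the weight-`c₁` carrier of the unit lattice exactly as in
`laplacePrimeA`, and `c := (Q′G′²Q′†)⁻¹ := greenK …` from the positivity `re⟪φ, Q′G′²Q′†φ⟫ = ‖G′Q′†φ‖² > 0` (`Q′†` injective because `Q′` is onto —
`B9Eq326OperatorAssembly.QprimeW_surjective`, `B11Eq103H1Complex.adjoint_injective_of_surjective`; `G′` injective).  §3: at every UNITARY background
with a tracial `τ` and the cell's norming `⟪φ⁻¹X, φ⁻¹Y⟫ = τ(X*Y)` both displayed letters are discharged (`B9Eq310HessianHermitian.adTransportW_adjoint`,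
`B9Thm311DeltaPrimeA.laplacePrimeA_pos`): (3.25) holds for the chain's `R(U)` with NO window on `U` — print's «some regularity of the configuration U»
is not needed, as `B9Thm311DeltaPrimeA` already observed for `Δ′_a > 0`.

WHAT IS PROVED (sorry-free; proof lane — no `def`, no `Prop` placeholder, nothing of [B9] asserted hypothesis-free).
* §1 (abstract, `RCLike 𝕜`): `formula_mem` (`f − G′Q′*cQ′G′f ∈ Δ(N(Q′))`), `inner_formula_rem_eq_zero` (`G′Q′*ψ ⊥ Δ(N(Q′))`),
  **`projR_eq_formula`** (`B11Eq103H1Complex.projR Δ Q′ f = f − G′(Q′*(c(Q′(G′f))))`); for `G′ := greenK Δ′` of a symmetric positive definite `Δ′`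
  and the Hilbert adjoint `Q′†` of an onto `Q′`: `inner_qggq_eq` (`⟪ψ, Q′G′²Q′†ψ⟫ = ‖G′Q′†ψ‖²`), **`qggq_pos`** (`ψ ≠ 0 → 0 < re⟪ψ, Q′G′²Q′†ψ⟫` — the
  existence half of print's «(Q′G′²Q′*)⁻¹ … well defined»).
* §2 (the chain, mutually adjoint transporters `hRS`, displayed positivity `hpos′` of `Δ′_a(U)`): `laplacePrimeA_isSymmetric`, **`QGGQ_pos`**,
  **`RofU_eq_formula`** ((3.25) for `RofU`, `(Q′G′²Q′†)⁻¹ := greenK … (QGGQ_pos …)` CONSTRUCTED).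
* §3 (unitary background): **`QGGQ_pos_of_unitary`**, **`RofU_eq_formula_of_unitary`**.
* §4 (flat background `U ≡ 1`, the comparison point of every `‖R(U) − R(1)‖`): `adTransportW_adjoint_one`, `QGGQ_pos_one`, **`RofU_eq_formula_one`** —
  from `η ≠ 0`, `a′ > 0` only (`B9Thm311DeltaPrimeA.laplacePrimeA_one_pos`).
HONEST SCOPE.  [folklore] finite-dimensional Hilbert-space algebra (Lagrange multipliers ∕ orthogonal projection) at the chain's letters; the bounds
(3.42)–(3.49), (3.63)–(3.68) are NOT touched; ONE sub-step (S3a) of a route step, NOT NE9 (cell pub-balaban: NE9 NOT PRINTED ∕ NOT PROVED; spine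
PROVED 0∕9; rung (B)+1 on a finite T⁴ — NOT infinite volume, NOT mass gap, NOT Clay).  NEW file; nothing modified.  Net new unproved facts: 0.
-/

noncomputable section

open scoped InnerProductSpace ComplexConjugate BigOperators

namespace Literature.MathematicalPhysics.QuantumFieldTheory.Balaban1983to89.B9Eq325ProjFormula

open B4Sect5Torus (TSite)
open B9SectCLatticeCarrier (Bond)
open B9Eq311L2Pairing (WL2)
open B9Eq319QprimeTorus (fineP)
open B11Eq103H1Complex (SiteL2K projR greenK apply_greenK greenK_injective covLaplaceSiteK covDerivL2K covDivL2K adjoint_covDerivL2K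
  adjoint_injective_of_surjective)
open B9Eq310HessianOperator (adTransportW adTransportW_apply)
open B9Eq310HessianHermitian (adTransportW_adjoint)
open B9Eq326OperatorAssembly (QprimeW QprimeW_surjective RofU)
open B9Eq3119DeltaPiCarrier (laplacePrimeA laplacePrimeA_apply_of_ker GpOfU)
open B9Thm311DeltaPrimeA (laplacePrimeA_pos laplacePrimeA_one_pos)

/-! ## §1 (3.25) = (3.21) over `RCLike 𝕜` from one-sided Green data -/

section Abstract

variable {𝕜 : Type*} [RCLike 𝕜] {E : Type*} [NormedAddCommGroup E] [InnerProductSpace 𝕜 E]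
  {F : Type*} [NormedAddCommGroup F] [InnerProductSpace 𝕜 F] {F' : Type*} [AddCommGroup F'] [Module 𝕜 F']
  (Δs T g : E →ₗ[𝕜] E) (Q' : E →ₗ[𝕜] F') (q : E →ₗ[𝕜] F) (qs : F →ₗ[𝕜] E) (c : F →ₗ[𝕜] F)

/-- **`Rf ∈ Δ^η_U N(Q′)`** for `R := I − G′Q′*cQ′G′`: with `λ₀ := G′Rf` one has `Q′λ₀ = Q′G′f − (Q′G′²Q′*)c(Q′G′f) = 0` and `Δλ₀ = Δ′λ₀ = Rf` — print's
(3.22) minimiser.  Hypotheses: the kernel of the Hilbert-space reading `q` of `Q′` is contained in `N(Q′)`, `Δ′ = Δ` on `N(Q′)`, `Δ′∘G′ = id`,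
`(Q′G′²Q′*)∘c = id`. [cite: Balaban1985BackgroundPropagators, (3.21)–(3.22) p.394, (3.25) p.394] -/
theorem formula_mem (hker : ∀ l, q l = 0 → Q' l = 0) (hT : ∀ l, Q' l = 0 → T l = Δs l) (hg : ∀ x, T (g x) = x)
    (hc : ∀ ψ, q (g (g (qs (c ψ)))) = ψ) (f : E) :
    f - g (qs (c (q (g f)))) ∈ (LinearMap.ker Q').map Δs := by
  have hq : q (g (f - g (qs (c (q (g f)))))) = 0 := by rw [map_sub, map_sub, hc, sub_self]
  refine Submodule.mem_map.2 ⟨g (f - g (qs (c (q (g f))))), LinearMap.mem_ker.2 (hker _ hq), ?_⟩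
  rw [← hT _ (hker _ hq), hg]

/-- **`f − Rf = G′Q′*ψ ⊥ Δ^η_U N(Q′)`**: for `ω = Δλ′`, `Q′λ′ = 0`, `⟪G′Q′*ψ, Δ′λ′⟫ = ⟪Δ′G′Q′*ψ, λ′⟫ = ⟪Q′*ψ, λ′⟫ = conj⟪Q′λ′, ψ⟫ = 0`
(`Δ′` symmetric, `Q′*` the adjoint of the Hilbert reading `q` of `Q′`, whose kernel contains `N(Q′)`). [cite: Balaban1985BackgroundPropagators, (3.21) p.394, (3.25) p.394] -/
theorem inner_formula_rem_eq_zero (hker' : ∀ l, Q' l = 0 → q l = 0) (hT : ∀ l, Q' l = 0 → T l = Δs l)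
    (hTsymm : ∀ x y : E, ⟪T x, y⟫_𝕜 = ⟪x, T y⟫_𝕜) (hadj : ∀ (x : E) (ψ : F), ⟪q x, ψ⟫_𝕜 = ⟪x, qs ψ⟫_𝕜) (hg : ∀ x, T (g x) = x)
    (ψ : F) (ω : E) (hω : ω ∈ (LinearMap.ker Q').map Δs) :
    ⟪g (qs ψ), ω⟫_𝕜 = 0 := by
  obtain ⟨l, hl, rfl⟩ := Submodule.mem_map.1 hω
  have hl' : Q' l = 0 := LinearMap.mem_ker.1 hl
  rw [← hT l hl', ← hTsymm, hg, ← inner_conj_symm, ← hadj, hker' l hl', inner_zero_left, map_zero]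

variable [FiniteDimensional 𝕜 E]

/-- **(3.25) EQUALS (3.21) over `RCLike 𝕜`**: the orthogonal projection onto `Δ^η_U N(Q′)` (`B11Eq103H1Complex.projR Δ Q′`, Mathlib's
`starProjection` of `(ker Q′).map Δ`) is `f ↦ f − G′(Q′*(c(Q′(G′f))))` whenever `Δ′` agrees with `Δ` on `N(Q′)`, `Δ′` is symmetric, `G′` is a RIGHT
inverse of `Δ′`, `c` a RIGHT inverse of `Q′G′²Q′*`, and `Q′*` is the adjoint of a Hilbert-space reading `q` of `Q′` with the same kernel
(`Submodule.eq_starProjection_of_mem_of_inner_eq_zero`).  No two-sided data, no symmetry of `a`, no port of `B5Projector144`.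
[cite: Balaban1985BackgroundPropagators, (3.21) p.394, (3.25) p.394] -/
theorem projR_eq_formula (hker : ∀ l, q l = 0 ↔ Q' l = 0) (hT : ∀ l, Q' l = 0 → T l = Δs l)
    (hTsymm : ∀ x y : E, ⟪T x, y⟫_𝕜 = ⟪x, T y⟫_𝕜) (hadj : ∀ (x : E) (ψ : F), ⟪q x, ψ⟫_𝕜 = ⟪x, qs ψ⟫_𝕜) (hg : ∀ x, T (g x) = x)
    (hc : ∀ ψ, q (g (g (qs (c ψ)))) = ψ) (f : E) :
    projR Δs Q' f = f - g (qs (c (q (g f)))) := by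
  haveI : CompleteSpace ((LinearMap.ker Q').map Δs) := FiniteDimensional.complete 𝕜 _
  unfold projR
  rw [ContinuousLinearMap.coe_coe]
  refine Submodule.eq_starProjection_of_mem_of_inner_eq_zero
    (formula_mem Δs T g Q' q qs c (fun l => (hker l).1) hT hg hc f) fun ω hω => ?_
  rw [sub_sub_cancel]
  exact inner_formula_rem_eq_zero Δs T g Q' q qs (fun l => (hker l).2) hT hTsymm hadj hg _ ω hω

variable [FiniteDimensional 𝕜 F] {T}

/-- **`⟪ψ, Q′G′²Q′†ψ⟫ = ‖G′Q′†ψ‖²`** for the inverse `G′ = greenK Δ′` of a SYMMETRIC positive definite `Δ′` (`x = Δ′G′x`, so `G′` is symmetric too) and the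
Hilbert adjoint `Q′†`. [cite: Balaban1985BackgroundPropagators, (3.25) p.394, Thm 3.11 p.416] -/
theorem inner_qggq_eq (hTs : T.IsSymmetric) (hpos : ∀ x : E, x ≠ 0 → 0 < RCLike.re ⟪x, T x⟫_𝕜) (ψ : F) :
    ⟪ψ, q (greenK T hpos (greenK T hpos (LinearMap.adjoint q ψ)))⟫_𝕜 =
      ((‖greenK T hpos (LinearMap.adjoint q ψ)‖ : ℝ) : 𝕜) ^ 2 := by
  rw [← LinearMap.adjoint_inner_left]
  set x := LinearMap.adjoint q ψ
  -- `⟪x, G′G′x⟫ = ⟪Δ′G′x, G′G′x⟫ = ⟪G′x, Δ′G′G′x⟫ = ⟪G′x, G′x⟫`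
  calc ⟪x, greenK T hpos (greenK T hpos x)⟫_𝕜 = ⟪T (greenK T hpos x), greenK T hpos (greenK T hpos x)⟫_𝕜 := by rw [apply_greenK]
    _ = ⟪greenK T hpos x, T (greenK T hpos (greenK T hpos x))⟫_𝕜 := hTs _ _
    _ = ((‖greenK T hpos x‖ : ℝ) : 𝕜) ^ 2 := by rw [apply_greenK, inner_self_eq_norm_sq_to_K]

/-- **`Q′G′²Q′†` IS POSITIVE DEFINITE when `Q′` is onto** — the existence clause for print's `(Q′G′²Q′*)⁻¹` («We do not know yet if the operators in
the above formulas are well defined»; Thm 3.11: «… (Q′G′²Q′*)⁻¹ … positive definite»): `re⟪ψ, Q′G′²Q′†ψ⟫ = ‖G′Q′†ψ‖² > 0` for `ψ ≠ 0`, because `G′`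
and `Q′†` are injective (`B11Eq103H1Complex.greenK_injective`, `adjoint_injective_of_surjective`). [cite: Balaban1985BackgroundPropagators, (3.25) p.394, Thm 3.11 p.416, (3.19) p.393] -/
theorem qggq_pos (hTs : T.IsSymmetric) (hpos : ∀ x : E, x ≠ 0 → 0 < RCLike.re ⟪x, T x⟫_𝕜) (hq : Function.Surjective q) (ψ : F)
    (hψ : ψ ≠ 0) : 0 < RCLike.re ⟪ψ, (q ∘ₗ greenK T hpos ∘ₗ greenK T hpos ∘ₗ LinearMap.adjoint q) ψ⟫_𝕜 := by
  simp only [LinearMap.comp_apply]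
  rw [inner_qggq_eq q hTs hpos ψ]
  norm_cast
  refine pow_pos (norm_pos_iff.2 fun h0 => hψ (adjoint_injective_of_surjective q hq ?_)) 2
  rw [map_zero]
  exact greenK_injective hpos (by rw [map_zero]; exact h0)

end Abstract

/-! ## §2 The chain's `R(U)`: `Δ′ := Δ′_a(U)`, `G′ := (Δ′_a(U))⁻¹`, `Q′* := Q′†` on the weight-`c₁` carrier, `(Q′G′²Q′†)⁻¹` CONSTRUCTED -/

section Chain

variable {d : ℕ} (L : ℕ) [NeZero L] (m : Fin d → ℕ) {𝔸 : Type*} [Ring 𝔸] [StarRing 𝔸] [Algebra ℂ 𝔸] [StarModule ℂ 𝔸]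
  {W : Type*} [NormedAddCommGroup W] [InnerProductSpace ℂ W] [FiniteDimensional ℂ W] (φ : W ≃ₗ[ℂ] 𝔸) (c₀ : ℝ) [Fact (0 < c₀)]
  (η : ℝ) (U : Bond d (fineP L m) → 𝔸ˣ) (c₁ : ℝ) [Fact (0 < c₁)] (a' : ℝ)
  (hRS : ∀ (b : Bond d (fineP L m)) (v u : W), ⟪adTransportW φ U b v, u⟫_ℂ = ⟪v, adTransportW φ (fun b => (U b)⁻¹) b u⟫_ℂ)
  (hpos' : ∀ x : SiteL2K ℂ d (fineP L m) c₀ W, x ≠ 0 → 0 < RCLike.re ⟪x, laplacePrimeA L m φ η U a' (c₁ := c₁) x⟫_ℂ)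

omit [StarRing 𝔸] [StarModule ℂ 𝔸] in
include hRS in
/-- **`Δ′_a(U)` IS SYMMETRIC** for mutually adjoint transporters: `Δ^η_U = D*_U D_U = D_U† D_U` (`B11Eq103H1Complex.adjoint_covDerivL2K`) and the penalty
`a′·Q′†Q′` with real `a′`. [cite: Balaban1985BackgroundPropagators, (3.23)–(3.24) p.394, p.395] -/
theorem laplacePrimeA_isSymmetric : (laplacePrimeA L m φ η U a' (c₀ := c₀) (c₁ := c₁)).IsSymmetric := by
  have hc : conj (((η : ℂ))⁻¹) = ((η : ℂ))⁻¹ := by rw [map_inv₀, Complex.conj_ofReal]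
  intro x y
  simp only [laplacePrimeA, covLaplaceSiteK, LinearMap.add_apply, LinearMap.smul_apply, LinearMap.comp_apply, inner_add_left, inner_add_right,
    inner_smul_left, inner_smul_right, Complex.conj_ofReal]
  rw [← adjoint_covDerivL2K _ hc _ _ hRS, LinearMap.adjoint_inner_left, LinearMap.adjoint_inner_right, LinearMap.adjoint_inner_left,
    LinearMap.adjoint_inner_right]
  simp only [LinearMap.comp_apply]

omit [StarRing 𝔸] [StarModule ℂ 𝔸] in
include hRS in
/-- **Thm 3.11's THIRD operator: `Q′G′(U)²Q′†` IS POSITIVE DEFINITE on the `L²` space of the unit lattice** (`G′(U) = (Δ′_a(U))⁻¹ = GpOfU` at the displayed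
positivity `hpos′`, `Q′(U)` read into the weight-`c₁` carrier as in `laplacePrimeA`, onto by `B9Eq326OperatorAssembly.QprimeW_surjective`) — so that
print's `(Q′G′²Q′*)⁻¹` is CONSTRUCTED as `greenK … (QGGQ_pos …)`. [cite: Balaban1985BackgroundPropagators, Thm 3.11 p.416, (3.25) p.394] -/
theorem QGGQ_pos (ψ : SiteL2K ℂ d m c₁ W) (hψ : ψ ≠ 0) :
    0 < RCLike.re ⟪ψ, (((WL2.linearEquiv ℂ ℂ (fun _ : TSite d m => c₁)).symm.toLinearMap ∘ₗ QprimeW L m φ U (c₀ := c₀)) ∘ₗ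
        GpOfU L m φ η U a' (c₁ := c₁) hpos' ∘ₗ GpOfU L m φ η U a' (c₁ := c₁) hpos' ∘ₗ
          LinearMap.adjoint ((WL2.linearEquiv ℂ ℂ (fun _ : TSite d m => c₁)).symm.toLinearMap ∘ₗ QprimeW L m φ U (c₀ := c₀))) ψ⟫_ℂ :=
  qggq_pos _ (laplacePrimeA_isSymmetric L m φ c₀ η U c₁ a' hRS) hpos'
    (((WL2.linearEquiv ℂ ℂ (fun _ : TSite d m => c₁)).symm.surjective).comp (QprimeW_surjective L m φ U)) ψ hψ

omit [StarRing 𝔸] [StarModule ℂ 𝔸] in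
include hRS in
/-- **(3.25) FOR THE CHAIN'S `R(U)`**: `B9Eq326OperatorAssembly.RofU` — the orthogonal projection onto `Δ^η_U N(Q′(U))` — equals
`f ↦ f − G′(Q′†((Q′G′²Q′†)⁻¹(Q′(G′f))))` with `G′ = GpOfU` ((3.24)–(3.25)'s `(Δ′_a(U))⁻¹` at the displayed positivity `hpos′`), `Q′(U)` read into the
weight-`c₁` carrier of the unit lattice as in `laplacePrimeA`, `Q′†` its Hilbert adjoint and `(Q′G′²Q′†)⁻¹ := greenK … (QGGQ_pos …)` — §1 with
`Δ′ = Δ^η_U` on `N(Q′(U))` (`laplacePrimeA_apply_of_ker`), `laplacePrimeA_isSymmetric`, `apply_greenK` twice.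
[cite: Balaban1985BackgroundPropagators, (3.21) p.394, (3.25) p.394] -/
theorem RofU_eq_formula (f : SiteL2K ℂ d (fineP L m) c₀ W) :
    RofU L m φ η U (c₀ := c₀) f = f - GpOfU L m φ η U a' (c₁ := c₁) hpos'
      (LinearMap.adjoint ((WL2.linearEquiv ℂ ℂ (fun _ : TSite d m => c₁)).symm.toLinearMap ∘ₗ QprimeW L m φ U (c₀ := c₀))
        (greenK _ (QGGQ_pos L m φ c₀ η U c₁ a' hRS hpos')
          (((WL2.linearEquiv ℂ ℂ (fun _ : TSite d m => c₁)).symm.toLinearMap ∘ₗ QprimeW L m φ U (c₀ := c₀))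
            (GpOfU L m φ η U a' (c₁ := c₁) hpos' f)))) := by
  have hker : ∀ l : SiteL2K ℂ d (fineP L m) c₀ W,
      ((WL2.linearEquiv ℂ ℂ (fun _ : TSite d m => c₁)).symm.toLinearMap ∘ₗ QprimeW L m φ U (c₀ := c₀)) l = 0 ↔ QprimeW L m φ U l = 0 :=
    fun l => by rw [LinearMap.comp_apply, LinearEquiv.coe_toLinearMap, LinearEquiv.map_eq_zero_iff]
  have hg : ∀ x : SiteL2K ℂ d (fineP L m) c₀ W, laplacePrimeA L m φ η U a' (c₁ := c₁) (GpOfU L m φ η U a' (c₁ := c₁) hpos' x) = x :=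
    fun x => apply_greenK hpos' x
  have hc := apply_greenK (QGGQ_pos L m φ c₀ η U c₁ a' hRS hpos')
  simp only [LinearMap.comp_apply] at hc
  exact projR_eq_formula (𝕜 := ℂ) _ (laplacePrimeA L m φ η U a' (c₁ := c₁)) (GpOfU L m φ η U a' (c₁ := c₁) hpos') (QprimeW L m φ U)
    ((WL2.linearEquiv ℂ ℂ (fun _ : TSite d m => c₁)).symm.toLinearMap ∘ₗ QprimeW L m φ U (c₀ := c₀))
    (LinearMap.adjoint ((WL2.linearEquiv ℂ ℂ (fun _ : TSite d m => c₁)).symm.toLinearMap ∘ₗ QprimeW L m φ U (c₀ := c₀))) _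
    hker (fun l hl => laplacePrimeA_apply_of_ker L m φ η U a' hl) (laplacePrimeA_isSymmetric L m φ c₀ η U c₁ a' hRS)
    (fun x ψ => (LinearMap.adjoint_inner_right _ x ψ).symm) hg hc f

end Chain

/-! ## §3 At every unitary background: both displayed letters discharged -/

section Unitary

variable {d : ℕ} (L : ℕ) [NeZero L] (m : Fin d → ℕ) {𝔸 : Type*} [Ring 𝔸] [StarRing 𝔸] [Algebra ℂ 𝔸] [StarModule ℂ 𝔸]
  {W : Type*} [NormedAddCommGroup W] [InnerProductSpace ℂ W] [FiniteDimensional ℂ W] (φ : W ≃ₗ[ℂ] 𝔸) (c₀ : ℝ) [Fact (0 < c₀)]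
  (η : ℝ) (U : Bond d (fineP L m) → 𝔸ˣ) (c₁ : ℝ) [Fact (0 < c₁)] (a' : ℝ) (τ : 𝔸 →ₗ[ℂ] ℂ)
  (hτ₂ : ∀ X Y : 𝔸, τ (X * Y) = τ (Y * X)) (hφ : ∀ X Y : 𝔸, ⟪φ.symm X, φ.symm Y⟫_ℂ = τ (star X * Y))
  (hU : ∀ b, star (U b : 𝔸) = ((U b)⁻¹ : 𝔸ˣ)) (hη : η ≠ 0) (ha : 0 < a')

omit [StarModule ℂ 𝔸] in
/-- **Thm 3.11's THIRD operator at every unitary background: `Q′G′(U)²Q′†` is positive definite**, `G′(U) = (Δ′_a(U))⁻¹` at print's own positivity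
(`B9Thm311DeltaPrimeA.laplacePrimeA_pos`), transporters mutually adjoint by `B9Eq310HessianHermitian.adTransportW_adjoint` — from `hτ₂`, `hφ`, `hU`,
`η ≠ 0`, `a′ > 0` alone (no window on `U`). [cite: Balaban1985BackgroundPropagators, Thm 3.11 p.416, (3.25) p.394] -/
theorem QGGQ_pos_of_unitary (ψ : SiteL2K ℂ d m c₁ W) (hψ : ψ ≠ 0) :
    0 < RCLike.re ⟪ψ, (((WL2.linearEquiv ℂ ℂ (fun _ : TSite d m => c₁)).symm.toLinearMap ∘ₗ QprimeW L m φ U (c₀ := c₀)) ∘ₗ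
        GpOfU L m φ η U a' (c₁ := c₁) (laplacePrimeA_pos L m φ η U a' τ hτ₂ hφ hU hη ha) ∘ₗ
          GpOfU L m φ η U a' (c₁ := c₁) (laplacePrimeA_pos L m φ η U a' τ hτ₂ hφ hU hη ha) ∘ₗ
            LinearMap.adjoint ((WL2.linearEquiv ℂ ℂ (fun _ : TSite d m => c₁)).symm.toLinearMap ∘ₗ QprimeW L m φ U (c₀ := c₀))) ψ⟫_ℂ :=
  QGGQ_pos L m φ c₀ η U c₁ a' (adTransportW_adjoint φ τ hτ₂ hU hφ) _ ψ hψ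

omit [StarModule ℂ 𝔸] in
/-- **(3.25) FOR THE CHAIN'S `R(U)` AT EVERY UNITARY BACKGROUND**: `R(U)f = f − G′(U)(Q′†((Q′G′(U)²Q′†)⁻¹(Q′(G′(U)f))))` with `G′(U) = (Δ′_a(U))⁻¹`
and `(Q′G′(U)²Q′†)⁻¹` both CONSTRUCTED (`greenK` at `laplacePrimeA_pos` ∕ `QGGQ_pos_of_unitary`) — print's (3.25), «We do not know yet if the
operators … are well defined» settled for unitary `U` without «some regularity of the configuration». [cite: Balaban1985BackgroundPropagators, (3.21) p.394, (3.25) p.394, Thm 3.11 p.416] -/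
theorem RofU_eq_formula_of_unitary (f : SiteL2K ℂ d (fineP L m) c₀ W) :
    RofU L m φ η U (c₀ := c₀) f = f - GpOfU L m φ η U a' (c₁ := c₁) (laplacePrimeA_pos L m φ η U a' τ hτ₂ hφ hU hη ha)
      (LinearMap.adjoint ((WL2.linearEquiv ℂ ℂ (fun _ : TSite d m => c₁)).symm.toLinearMap ∘ₗ QprimeW L m φ U (c₀ := c₀))
        (greenK _ (QGGQ_pos_of_unitary L m φ c₀ η U c₁ a' τ hτ₂ hφ hU hη ha)
          (((WL2.linearEquiv ℂ ℂ (fun _ : TSite d m => c₁)).symm.toLinearMap ∘ₗ QprimeW L m φ U (c₀ := c₀))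
            (GpOfU L m φ η U a' (c₁ := c₁) (laplacePrimeA_pos L m φ η U a' τ hτ₂ hφ hU hη ha) f)))) :=
  RofU_eq_formula L m φ c₀ η U c₁ a' (adTransportW_adjoint φ τ hτ₂ hU hφ) _ f

end Unitary

/-! ## §4 At the flat background `U ≡ 1`: no letter at all -/

section Flat

variable {d : ℕ} (L : ℕ) [NeZero L] (m : Fin d → ℕ) {𝔸 : Type*} [Ring 𝔸] [Algebra ℂ 𝔸]
  {W : Type*} [NormedAddCommGroup W] [InnerProductSpace ℂ W] [FiniteDimensional ℂ W] (φ : W ≃ₗ[ℂ] 𝔸) (c₀ : ℝ) [Fact (0 < c₀)]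
  (η : ℝ) (c₁ : ℝ) [Fact (0 < c₁)] (a' : ℝ) (hη : η ≠ 0) (ha : 0 < a')

omit [NeZero L] [FiniteDimensional ℂ W] in
/-- At the flat background the transporters read on the fibre are the identity, hence trivially mutually adjoint: the `hRS` letter at `U ≡ 1`.
[cite: Balaban1985BackgroundPropagators, p.395] -/
theorem adTransportW_adjoint_one (b : Bond d (fineP L m)) (v u : W) :
    ⟪adTransportW φ (fun _ : Bond d (fineP L m) => (1 : 𝔸ˣ)) b v, u⟫_ℂ =
      ⟪v, adTransportW φ (fun b : Bond d (fineP L m) => ((fun _ : Bond d (fineP L m) => (1 : 𝔸ˣ)) b)⁻¹) b u⟫_ℂ := by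
  have h1 : adTransportW φ (fun _ : Bond d (fineP L m) => (1 : 𝔸ˣ)) b v = v := by
    rw [adTransportW_apply, Units.val_one, inv_one, Units.val_one, one_mul, mul_one, LinearEquiv.symm_apply_apply]
  have h2 : adTransportW φ (fun b : Bond d (fineP L m) => ((fun _ : Bond d (fineP L m) => (1 : 𝔸ˣ)) b)⁻¹) b u = u := by
    rw [adTransportW_apply, inv_one, Units.val_one, inv_one, Units.val_one, one_mul, mul_one, LinearEquiv.symm_apply_apply]
  rw [h1, h2]

include hη ha in
/-- **`Q′G′(1)²Q′†` is positive definite at the flat background**, `G′(1) = (Δ′_a(1))⁻¹` at `B9Thm311DeltaPrimeA.laplacePrimeA_one_pos` — `η ≠ 0`,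
`a′ > 0` only. [cite: Balaban1985BackgroundPropagators, Thm 3.11 p.416, (3.25) p.394] -/
theorem QGGQ_pos_one (ψ : SiteL2K ℂ d m c₁ W) (hψ : ψ ≠ 0) :
    0 < RCLike.re ⟪ψ, (((WL2.linearEquiv ℂ ℂ (fun _ : TSite d m => c₁)).symm.toLinearMap ∘ₗ
        QprimeW L m φ (fun _ : Bond d (fineP L m) => (1 : 𝔸ˣ)) (c₀ := c₀)) ∘ₗ
        GpOfU L m φ η (fun _ : Bond d (fineP L m) => (1 : 𝔸ˣ)) a' (c₁ := c₁) (laplacePrimeA_one_pos L m φ η a' hη ha) ∘ₗ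
          GpOfU L m φ η (fun _ : Bond d (fineP L m) => (1 : 𝔸ˣ)) a' (c₁ := c₁) (laplacePrimeA_one_pos L m φ η a' hη ha) ∘ₗ
            LinearMap.adjoint ((WL2.linearEquiv ℂ ℂ (fun _ : TSite d m => c₁)).symm.toLinearMap ∘ₗ
              QprimeW L m φ (fun _ : Bond d (fineP L m) => (1 : 𝔸ˣ)) (c₀ := c₀))) ψ⟫_ℂ :=
  QGGQ_pos L m φ c₀ η _ c₁ a' (adTransportW_adjoint_one L m φ) _ ψ hψ

include hη ha in
/-- **(3.25) FOR THE CHAIN'S `R(1)` AT THE FLAT BACKGROUND** — the comparison point of every Lipschitz letter `‖R(U) − R(1)‖`; `G′(1)` and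
`(Q′G′(1)²Q′†)⁻¹` CONSTRUCTED from `η ≠ 0`, `a′ > 0` only. [cite: Balaban1985BackgroundPropagators, (3.21) p.394, (3.25) p.394] -/
theorem RofU_eq_formula_one (f : SiteL2K ℂ d (fineP L m) c₀ W) :
    RofU L m φ η (fun _ : Bond d (fineP L m) => (1 : 𝔸ˣ)) (c₀ := c₀) f =
      f - GpOfU L m φ η (fun _ : Bond d (fineP L m) => (1 : 𝔸ˣ)) a' (c₁ := c₁) (laplacePrimeA_one_pos L m φ η a' hη ha)
        (LinearMap.adjoint ((WL2.linearEquiv ℂ ℂ (fun _ : TSite d m => c₁)).symm.toLinearMap ∘ₗ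
            QprimeW L m φ (fun _ : Bond d (fineP L m) => (1 : 𝔸ˣ)) (c₀ := c₀))
          (greenK _ (QGGQ_pos_one L m φ c₀ η c₁ a' hη ha)
            (((WL2.linearEquiv ℂ ℂ (fun _ : TSite d m => c₁)).symm.toLinearMap ∘ₗ
                QprimeW L m φ (fun _ : Bond d (fineP L m) => (1 : 𝔸ˣ)) (c₀ := c₀))
              (GpOfU L m φ η (fun _ : Bond d (fineP L m) => (1 : 𝔸ˣ)) a' (c₁ := c₁) (laplacePrimeA_one_pos L m φ η a' hη ha) f)))) :=
  RofU_eq_formula L m φ c₀ η _ c₁ a' (adTransportW_adjoint_one L m φ) _ f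

end Flat

end Literature.MathematicalPhysics.QuantumFieldTheory.Balaban1983to89.B9Eq325ProjFormula

end
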